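import Summits.AtomisticToContinuum.HydrodynamicLimit.Theorems.OneFlightGossipEngineCollisionActivityTailsActivityDomination
import Summits.AtomisticToContinuum.HydrodynamicLimit.Theorems.OneFlightGossipEngineCollisionActivityTailsAbnormalActivityStatics
import Summits.AtomisticToContinuum.HydrodynamicLimit.Theses.OneFlightGossipEngine
import Literature.MathematicalPhysics.KineticTheory.HardSphereEulerProofs
import Literature.Analysis.FluidPDE.HardSphereUniqueness
import Literature.Analysis.FluidPDE.HardSphereDynamicsProofs
import Literature.Analysis.FluidPDE.BoltzmannGradLimitProofs
import HarnessLib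

/-!
# `stub_labelEnvelopeOn`: marginal envelope ⇒ label-set and pair envelopes (line plaque-thinning-count-ld)

Crux `Summit.AtomisticToContinuum.HydrodynamicLimit.Theses.OneFlightGossipEngine.CollisionActivityTails`
(stmt-AtomisticToContinuum-13734), line `plaque-thinning-count-ld`, registered stub
`stub_labelEnvelopeOn : LabelEnvelopeFromEnvelope` — the static measure theory ("(S)") behind stub 5 of
the line. From the a.e. bounds `|f_N^{(k)}(r)| ≤ C^k e^{-β E_k}` of the volume-marginals on the FIRST `k`
labels of the density `𝟙_D · (W_N ∘ Φ_{-r})` of the law at time `r` (`EnvelopeOn`) we derive the LABEL-SET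
form `∫ G(w ∘ ι) d(law_r) ≤ C^m ∫ G e^{-β E_m} d(Haar ⊗ Lebesgue)^{⊗m}` for every injection
`ι : Fin m ↪ Fin (N+1)` (`LabelEnvelopeOn`), and the PAIR form with the position difference
(`PairEnvelopeOn`, translation invariance of the Haar probability measure of `𝕋³`). Ingredients: the law
at time `r` of `W₀ dZ` is `(W₀ ∘ Φ_{-r}) dZ` (`HardSphereFlow.lawAt_withDensity_holds`); it is invariant
under relabelling (symmetric canonical density, `HardSphereFlow.flow_comp_perm_ae`); Tonelli on
`Config (N+1) ≃ᵐ Config m × Config (N+1-m)` (`exists_castEquiv`, `exists_appendEquiv`) identifies the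
inner integral with `nthMarginal (N+1) m` at a.e. `Z_m` (sections of an integrable function are a.e.
integrable), where the envelope applies.
-/

noncomputable section

open MeasureTheory Set Filter Topology
open scoped ENNReal

namespace Summit.AtomisticToContinuum.HydrodynamicLimit.Theorems.CollisionActivityTailsEnvelopePlumbing

open Literature.MathematicalPhysics.KineticTheory Literature.Analysis.FluidPDE
open Summit.AtomisticToContinuum.HydrodynamicLimit.Theorems.CollisionActivityTailsActivityDomination (Flow Cfg window act tdist nearCount)
open Summit.AtomisticToContinuum.HydrodynamicLimit.Theorems.CollisionActivityTailsAbnormalActivityStatics (gaussPairWeight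
  measurable_gaussPairWeight PairLawEnvelope)

variable {N : ℕ} {a₀ θ₀ : T3 → ℝ} {u₀ : T3 → V3}

/-! ## Vocabulary (verbatim from the lead; `gaussPairWeight`, `PairLawEnvelope` imported from the landed Statics file) -/

/-- (from …PlaqueSplitDilute, lead) Envelope on a horizon: a.e. bounds of all bounded-order volume-marginals of 𝟙_D · (W_N ∘ Φ_{-r}), r ∈ [0,t₁]. -/
def EnvelopeOn (σ : ℝ) (a₀ θ₀ : T3 → ℝ) (u₀ : T3 → V3) (Φ : (N : ℕ) → Flow σ N) (t₁ β C : ℝ) : Prop :=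
  ∀ (N k : ℕ), ∀ r ∈ Set.Icc 0 t₁, ∀ᵐ Zk : Config k (Fin 3) T3,
    |nthMarginal (N + 1) k ((hardSphereDomain (Torus.geometry (Fin 3)) (N + 1) (hsDiameter σ N)).indicator
        (hsTransport (Φ N) r (canonicalDensity (Torus.geometry (Fin 3)) (hsDiameter σ N) (N + 1)
          (localGibbsProfile a₀ u₀ θ₀)))) Zk| ≤ C ^ k * Real.exp (-(β * configEnergy Zk))

/-- (from …AbnormalActivityHot, worker file, to land) Pair envelope on a horizon: the pair-law envelope of the laws at all times r ∈ [0, t₁]. -/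
def PairEnvelopeOn (σ : ℝ) (a₀ θ₀ : T3 → ℝ) (u₀ : T3 → V3) (Φ : (N : ℕ) → Flow σ N) (t₁ β C : ℝ) : Prop :=
  ∀ (N : ℕ), ∀ r ∈ Set.Icc 0 t₁, PairLawEnvelope ((localGibbsLaw σ a₀ u₀ θ₀ N (Φ N)).map ((Φ N).flow r)) C β

/-- (NEW, lead) Gaussian weight of an m-tuple of phase points. -/
def gaussTupleWeight (β : ℝ) {m : ℕ} (q : Fin m → T3 × V3) : ℝ≥0∞ :=
  ENNReal.ofReal (Real.exp (-(β * (2⁻¹ * ∑ a : Fin m, ‖(q a).2‖ ^ 2))))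

/-- (NEW, lead) LABEL-SET LAW ENVELOPE: for every injective labelling of m of the N+1 particles, the joint law of those m phase points under μ
is at most C^m · (Gaussian_β ⊗ Haar)^{⊗m} — the form of the marginal envelope that union bounds over clusters consume. -/
def LabelLawEnvelope (μ : Measure (Cfg N)) (C β : ℝ) : Prop :=
  ∀ (m : ℕ) (ι : Fin m ↪ Fin (N + 1)) (G : (Fin m → T3 × V3) → ℝ≥0∞), Measurable G →
    ∫⁻ w, G (fun a => w (ι a)) ∂μ ≤ ENNReal.ofReal (C ^ m) * ∫⁻ q : Fin m → T3 × V3, G q * gaussTupleWeight β q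

/-- (NEW, lead) Label-set envelope on a horizon. -/
def LabelEnvelopeOn (σ : ℝ) (a₀ θ₀ : T3 → ℝ) (u₀ : T3 → V3) (Φ : (N : ℕ) → Flow σ N) (t₁ β C : ℝ) : Prop :=
  ∀ (N : ℕ), ∀ r ∈ Set.Icc 0 t₁, LabelLawEnvelope ((localGibbsLaw σ a₀ u₀ θ₀ N (Φ N)).map ((Φ N).flow r)) C β

/-- (NEW, lead; REGISTERED stub `stub_labelEnvelopeOn` proves exactly this) marginal envelope ⇒ label-set envelope, and hence the pair envelope. -/
def LabelEnvelopeFromEnvelope : Prop :=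
  ∀ (a₀ θ₀ : T3 → ℝ) (u₀ : T3 → V3), Continuous a₀ → Continuous θ₀ → Continuous u₀ → (∀ x, 0 < a₀ x) → (∀ x, 0 < θ₀ x) →
    ∀ (σ : ℝ), 0 < σ → σ < 2⁻¹ → ∀ (Φ : (N : ℕ) → Flow σ N) (t₁ β C : ℝ), 0 ≤ C →
      EnvelopeOn σ a₀ θ₀ u₀ Φ t₁ β C → LabelEnvelopeOn σ a₀ θ₀ u₀ Φ t₁ β C ∧ PairEnvelopeOn σ a₀ θ₀ u₀ Φ t₁ β C

/-! ## §1 Static facts: the canonical density, the Gaussian weights -/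

/-- The canonical density is symmetric under relabelling of the particles. -/
theorem canonicalDensity_comp_perm_eq (ε : ℝ) (n : ℕ) (f : T3 × V3 → ℝ) (π : Equiv.Perm (Fin n))
    (z : Config n (Fin 3) T3) :
    canonicalDensity (Torus.geometry (Fin 3)) ε n f (z ∘ π : Config n (Fin 3) T3) =
      canonicalDensity (Torus.geometry (Fin 3)) ε n f z := by
  have ht : tensorPow n f (z ∘ π : Config n (Fin 3) T3) = tensorPow n f z :=
    isSymmetricFn_tensorPow n f π z
  have hD := comp_perm_mem_hardSphereDomain_iff (Torus.geometry (Fin 3)) ε π z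
  simp only [canonicalDensity]
  congr 1
  by_cases hz : z ∈ hardSphereDomain (Torus.geometry (Fin 3)) n ε
  · rw [indicator_of_mem hz, indicator_of_mem (hD.2 hz), ht]
  · rw [indicator_of_notMem hz, indicator_of_notMem (mt hD.1 hz)]

/-- The tuple Gaussian weight is measurable. -/
theorem measurable_gaussTupleWeight (β : ℝ) (m : ℕ) :
    Measurable (fun q : Fin m → T3 × V3 => gaussTupleWeight β q) := by
  unfold gaussTupleWeight
  fun_prop

/-! ## §2 The law at time `r` as a density -/

/-- The initial density `W₀ = canonicalDensity (localGibbsProfile)` is measurable (continuous profiles). -/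
theorem measurable_W₀ (ha : Continuous a₀) (hθ : Continuous θ₀) (hu : Continuous u₀) (σ : ℝ) (N : ℕ) :
    Measurable (canonicalDensity (Torus.geometry (Fin 3)) (hsDiameter σ N) (N + 1) (localGibbsProfile a₀ u₀ θ₀)) :=
  measurable_canonicalDensity _ _ (measurable_localGibbsProfile ha hθ hu)

/-- The density of the law at time `r`, `ρ_r = 𝟙_D · (W₀ ∘ Φ_{-r})`, is measurable. -/
theorem measurable_density (ha : Continuous a₀) (hθ : Continuous θ₀) (hu : Continuous u₀) (σ : ℝ)
    (N : ℕ) (Φ : Flow σ N) (r : ℝ) :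
    Measurable ((hardSphereDomain (Torus.geometry (Fin 3)) (N + 1) (hsDiameter σ N)).indicator
      (hsTransport Φ r (canonicalDensity (Torus.geometry (Fin 3)) (hsDiameter σ N) (N + 1) (localGibbsProfile a₀ u₀ θ₀)))) :=
  ((measurable_W₀ ha hθ hu σ N).comp (Φ.measurable_flow (-r))).indicator
    (measurableSet_hardSphereDomain _ Torus.measurable_geometry_sepVec _ _)

/-- The density of the law at time `r` is nonnegative (positive profiles). -/
theorem density_nonneg (ha0 : ∀ x, 0 < a₀ x) (hθ0 : ∀ x, 0 < θ₀ x) (σ : ℝ) (N : ℕ) (Φ : Flow σ N)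
    (r : ℝ) (z : Cfg N) :
    0 ≤ (hardSphereDomain (Torus.geometry (Fin 3)) (N + 1) (hsDiameter σ N)).indicator
      (hsTransport Φ r (canonicalDensity (Torus.geometry (Fin 3)) (hsDiameter σ N) (N + 1) (localGibbsProfile a₀ u₀ θ₀))) z :=
  have hf : 0 ≤ localGibbsProfile a₀ u₀ θ₀ :=
    fun y => localGibbsProfile_nonneg (fun x => (ha0 x).le) (fun x => (hθ0 x).le) y
  Set.indicator_nonneg (fun _ _ => mul_nonneg (inv_nonneg.2 (canonicalPartition_nonneg _ _ _ hf))
    (Set.indicator_nonneg (fun w _ => tensorPow_nonneg hf _ w) _)) z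

/-- **The law at time `r` as a density** (mild Liouville equation): the push-forward of the local
Gibbs law under `Φ_r` is `ρ_r dZ` with `ρ_r = 𝟙_D · (W₀ ∘ Φ_{-r})` — exactly the integrand of
`EnvelopeOn`. -/
theorem map_flow_localGibbsLaw_eq_withDensity (ha : Continuous a₀) (hθ : Continuous θ₀)
    (hu : Continuous u₀) (σ : ℝ) (N : ℕ) (Φ : Flow σ N) (r : ℝ) :
    (localGibbsLaw σ a₀ u₀ θ₀ N Φ).map (Φ.flow r) =
      volume.withDensity (fun z => ENNReal.ofReal
        ((hardSphereDomain (Torus.geometry (Fin 3)) (N + 1) (hsDiameter σ N)).indicator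
          (hsTransport Φ r (canonicalDensity (Torus.geometry (Fin 3)) (hsDiameter σ N) (N + 1) (localGibbsProfile a₀ u₀ θ₀))) z)) := by
  rw [localGibbsLaw, particleLaw_eq, ← HardSphereFlow.lawAt_eq,
    HardSphereFlow.lawAt_withDensity_holds Φ (measurable_W₀ ha hθ hu σ N).ennreal_ofReal r, liouville_eq,
    ← withDensity_indicator (measurableSet_hardSphereDomain _ Torus.measurable_geometry_sepVec _ _)]
  congr 1
  funext z
  by_cases hz : z ∈ hardSphereDomain (Torus.geometry (Fin 3)) (N + 1) (hsDiameter σ N)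
  · rw [indicator_of_mem hz, indicator_of_mem hz]
    rfl
  · rw [indicator_of_notMem hz, indicator_of_notMem hz, ENNReal.ofReal_zero]

/-- The density of the law at time `r` has total integral one (the law is a probability measure for
`σ ≤ 1/2`), hence is integrable. -/
theorem integrable_density (ha : Continuous a₀) (hθ : Continuous θ₀) (hu : Continuous u₀)
    (ha0 : ∀ x, 0 < a₀ x) (hθ0 : ∀ x, 0 < θ₀ x) {σ : ℝ} (hσ2 : σ < 2⁻¹) (N : ℕ) (Φ : Flow σ N)
    (r : ℝ) :
    Integrable ((hardSphereDomain (Torus.geometry (Fin 3)) (N + 1) (hsDiameter σ N)).indicator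
      (hsTransport Φ r (canonicalDensity (Torus.geometry (Fin 3)) (hsDiameter σ N) (N + 1) (localGibbsProfile a₀ u₀ θ₀)))) := by
  haveI := isProbabilityMeasure_localGibbsLaw ha hθ hu ha0 hθ0
    (show σ ≤ 1 / 2 by rw [one_div]; exact hσ2.le) N Φ
  haveI : IsProbabilityMeasure ((localGibbsLaw σ a₀ u₀ θ₀ N Φ).map (Φ.flow r)) :=
    Measure.isProbabilityMeasure_map (Φ.measurable_flow r).aemeasurable
  have hone := measure_univ (μ := (localGibbsLaw σ a₀ u₀ θ₀ N Φ).map (Φ.flow r))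
  rw [map_flow_localGibbsLaw_eq_withDensity ha hθ hu σ N Φ r, withDensity_apply _ MeasurableSet.univ,
    Measure.restrict_univ] at hone
  refine ⟨(measurable_density ha hθ hu σ N Φ r).aestronglyMeasurable,
    (hasFiniteIntegral_iff_ofReal (ae_of_all _ (density_nonneg (u₀ := u₀) ha0 hθ0 σ N Φ r))).2 ?_⟩
  simp [hone]

/-! ## §3 Relabelling invariance of the law at time `r` -/

/-- Relabelling the particles is measurable. -/
theorem measurable_comp_perm (π : Equiv.Perm (Fin (N + 1))) :
    Measurable (fun w : Cfg N => (w ∘ π : Cfg N)) :=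
  measurable_pi_lambda _ fun _ => measurable_pi_apply _

/-- The local Gibbs law is invariant under relabelling of the particles (the canonical density is
symmetric and relabelling preserves the Liouville measure). -/
theorem measurePreserving_comp_perm_localGibbsLaw (ha : Continuous a₀) (hθ : Continuous θ₀)
    (hu : Continuous u₀) (σ : ℝ) (N : ℕ) (Φ : Flow σ N) (π : Equiv.Perm (Fin (N + 1))) :
    MeasurePreserving (fun w : Cfg N => (w ∘ π : Cfg N))
      (localGibbsLaw σ a₀ u₀ θ₀ N Φ) (localGibbsLaw σ a₀ u₀ θ₀ N Φ) := by
  set W : Cfg N → ℝ≥0∞ := fun z => ENNReal.ofReal (canonicalDensity (Torus.geometry (Fin 3)) (hsDiameter σ N) (N + 1)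
    (localGibbsProfile a₀ u₀ θ₀) z)
  have hW : Measurable W := (measurable_W₀ ha hθ hu σ N).ennreal_ofReal
  have hπ := measurable_comp_perm (N := N) π
  refine ⟨hπ, ?_⟩
  rw [localGibbsLaw, particleLaw_eq]
  ext s hs
  rw [Measure.map_apply hπ hs, withDensity_apply _ (hπ hs), withDensity_apply _ hs,
    ← lintegral_indicator (hπ hs), ← lintegral_indicator hs]
  have hind : ((fun w : Cfg N => (w ∘ π : Cfg N)) ⁻¹' s).indicator W =
      fun z : Cfg N => s.indicator W (z ∘ π : Cfg N) := by
    funext z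
    by_cases hz : (z ∘ π : Cfg N) ∈ s
    · rw [indicator_of_mem hz, indicator_of_mem (show z ∈ (fun w : Cfg N => (w ∘ π : Cfg N)) ⁻¹' s from hz)]
      exact congrArg ENNReal.ofReal (canonicalDensity_comp_perm_eq _ _ _ π z).symm
    · rw [indicator_of_notMem hz, indicator_of_notMem (show z ∉ (fun w : Cfg N => (w ∘ π : Cfg N)) ⁻¹' s from hz)]
  rw [hind]
  exact (HardSphereFlow.measurePreserving_comp_perm_liouville (G := Torus.geometry (Fin 3))
    (ε := hsDiameter σ N) (d := Fin 3) (N := N + 1) π).lintegral_comp (hW.indicator hs)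

/-- **The law at time `r` is invariant under relabelling**: the flow commutes with relabelling
almost everywhere (`HardSphereFlow.flow_comp_perm_ae`) and the initial law is relabelling-invariant
and absolutely continuous with respect to the Liouville measure. -/
theorem measurePreserving_comp_perm_map_flow (ha : Continuous a₀) (hθ : Continuous θ₀)
    (hu : Continuous u₀) (σ : ℝ) (N : ℕ) (Φ : Flow σ N) (π : Equiv.Perm (Fin (N + 1))) (r : ℝ) :
    MeasurePreserving (fun w : Cfg N => (w ∘ π : Cfg N))
      ((localGibbsLaw σ a₀ u₀ θ₀ N Φ).map (Φ.flow r)) ((localGibbsLaw σ a₀ u₀ θ₀ N Φ).map (Φ.flow r)) := by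
  have hπ := measurable_comp_perm (N := N) π
  have hP := measurePreserving_comp_perm_localGibbsLaw ha hθ hu σ N Φ π
  have hac : localGibbsLaw σ a₀ u₀ θ₀ N Φ ≪ liouville (Torus.geometry (Fin 3)) (N + 1) (hsDiameter σ N) := by
    rw [localGibbsLaw, particleLaw_eq]
    exact withDensity_absolutelyContinuous _ _
  have hae : (fun w : Cfg N => (w ∘ π : Cfg N)) ∘ Φ.flow r =ᵐ[localGibbsLaw σ a₀ u₀ θ₀ N Φ]
      Φ.flow r ∘ fun w : Cfg N => (w ∘ π : Cfg N) := by
    filter_upwards [hac.ae_le (Φ.flow_comp_perm_ae π r)] with z hz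
    simp only [Function.comp_apply]
    exact hz.symm
  refine ⟨hπ, ?_⟩
  rw [Measure.map_map hπ (Φ.measurable_flow r), Measure.map_congr hae,
    ← Measure.map_map (Φ.measurable_flow r) hπ, hP.map_eq]

/-! ## §4 Tonelli: the first `m` labels -/

/-- **The envelope on the first `m` labels.** If the `m`-th volume-marginal of the density `ρ_r`
of the law at time `r` is a.e. bounded by `C^m e^{-β E_m}`, then for every measurable `G ≥ 0` of
the first `m` phase points, `∫ G(w_0,…,w_{m-1}) d(law_r) ≤ C^m ∫ G · e^{-β E_m} dZ_m` (Tonelli on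
`Config (N+1) ≃ Config m × Config (N+1-m)`; the inner integral is `nthMarginal (N+1) m ρ_r` at
almost every `Z_m`, where the section of the integrable `ρ_r` is integrable). -/
theorem lintegral_castLE_le (ha : Continuous a₀) (hθ : Continuous θ₀) (hu : Continuous u₀)
    (ha0 : ∀ x, 0 < a₀ x) (hθ0 : ∀ x, 0 < θ₀ x) {σ : ℝ} (hσ2 : σ < 2⁻¹) {N : ℕ} (Φ : Flow σ N)
    {m : ℕ} (hm : m ≤ N + 1) (r β : ℝ) {C : ℝ} (hC : 0 ≤ C)
    (hEnv : ∀ᵐ Zk : Config m (Fin 3) T3,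
      |nthMarginal (N + 1) m ((hardSphereDomain (Torus.geometry (Fin 3)) (N + 1) (hsDiameter σ N)).indicator
        (hsTransport Φ r (canonicalDensity (Torus.geometry (Fin 3)) (hsDiameter σ N) (N + 1) (localGibbsProfile a₀ u₀ θ₀)))) Zk|
        ≤ C ^ m * Real.exp (-(β * configEnergy Zk)))
    {G : (Fin m → T3 × V3) → ℝ≥0∞} (hG : Measurable G) :
    ∫⁻ w, G (fun a => w (Fin.castLE hm a)) ∂(localGibbsLaw σ a₀ u₀ θ₀ N Φ).map (Φ.flow r) ≤
      ENNReal.ofReal (C ^ m) * ∫⁻ q, G q * gaussTupleWeight β q := by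
  -- instance shortcuts (the searches for `SFinite volume` on configuration spaces are deep)
  haveI hY : SigmaFinite (volume : Measure (T3 × V3)) := inferInstance
  haveI hCm : SigmaFinite (volume : Measure (Config m (Fin 3) T3)) := inferInstance
  haveI hCr : SigmaFinite (volume : Measure (Config (N + 1 - m) (Fin 3) T3)) := inferInstance
  set ρ : Cfg N → ℝ := (hardSphereDomain (Torus.geometry (Fin 3)) (N + 1) (hsDiameter σ N)).indicator
    (hsTransport Φ r (canonicalDensity (Torus.geometry (Fin 3)) (hsDiameter σ N) (N + 1) (localGibbsProfile a₀ u₀ θ₀)))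
  have hρm : Measurable ρ := measurable_density ha hθ hu σ N Φ r
  have hρ0 : ∀ z, 0 ≤ ρ z := density_nonneg (u₀ := u₀) ha0 hθ0 σ N Φ r
  have hρi : Integrable ρ := integrable_density ha hθ hu ha0 hθ0 hσ2 N Φ r
  have hlaw := map_flow_localGibbsLaw_eq_withDensity ha hθ hu σ N Φ r
  -- the two reindexing equivalences
  obtain ⟨e₁, he₁, hmp₁⟩ := exists_castEquiv (Nat.add_sub_of_le hm) (T3 × V3)
  obtain ⟨e₂, he₂, hmp₂⟩ := exists_appendEquiv m (N + 1 - m) (T3 × V3)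
  -- the recast density and its sections
  set ρ' : Config (m + (N + 1 - m)) (Fin 3) T3 → ℝ :=
    fun z => ρ fun i => z (Fin.cast (Nat.add_sub_of_le hm).symm i)
  have hρ'm : Measurable ρ' := hρm.comp (measurable_pi_lambda _ fun _ => measurable_pi_apply _)
  have hρ'i : Integrable ρ' := integrable_recast hm hρi
  have happ : Measurable fun p : Config m (Fin 3) T3 × Config (N + 1 - m) (Fin 3) T3 =>
      Fin.append p.1 p.2 := by
    rw [show (fun p : Config m (Fin 3) T3 × Config (N + 1 - m) (Fin 3) T3 => Fin.append p.1 p.2) = e₂ from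
      funext fun p => (he₂ p).symm]
    exact e₂.measurable
  have hsec : ∀ᵐ Zm : Config m (Fin 3) T3,
      Integrable (fun Zr : Config (N + 1 - m) (Fin 3) T3 => ρ' (Fin.append Zm Zr)) :=
    (integrable_comp_append hρ'i).prod_right_ae
  have hGm : Measurable fun w : Cfg N => G fun a => w (Fin.castLE hm a) :=
    hG.comp (measurable_pi_lambda _ fun _ => measurable_pi_apply _)
  have hF : Measurable fun p : Config m (Fin 3) T3 × Config (N + 1 - m) (Fin 3) T3 =>
      ENNReal.ofReal (ρ' (Fin.append p.1 p.2)) * G p.1 :=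
    (hρ'm.comp happ).ennreal_ofReal.mul (hG.comp measurable_fst)
  calc ∫⁻ w, G (fun a => w (Fin.castLE hm a)) ∂(localGibbsLaw σ a₀ u₀ θ₀ N Φ).map (Φ.flow r)
      = ∫⁻ w, ENNReal.ofReal (ρ w) * G (fun a => w (Fin.castLE hm a)) := by
        rw [hlaw, lintegral_withDensity_eq_lintegral_mul _ hρm.ennreal_ofReal hGm]
        rfl
    _ = ∫⁻ p : Config m (Fin 3) T3 × Config (N + 1 - m) (Fin 3) T3,
          ENNReal.ofReal (ρ' (Fin.append p.1 p.2)) * G p.1 := by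
        rw [← hmp₁.lintegral_comp_emb e₁.measurableEmbedding,
          ← hmp₂.lintegral_comp_emb e₂.measurableEmbedding]
        refine lintegral_congr fun p => ?_
        rw [he₁, he₂]
        congr 2
        funext a
        exact Fin.append_left p.1 p.2 a
    _ = ∫⁻ Zm, (∫⁻ Zr, ENNReal.ofReal (ρ' (Fin.append Zm Zr))) * G Zm := by
        rw [Measure.volume_eq_prod, lintegral_prod _ hF.aemeasurable]
        refine lintegral_congr fun Zm => ?_
        dsimp only
        exact lintegral_mul_const (G Zm)
          (show Measurable (fun Zr : Config (N + 1 - m) (Fin 3) T3 =>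
              ENNReal.ofReal (ρ' (Fin.append Zm Zr))) from
            (hρ'm.comp (happ.comp measurable_prodMk_left)).ennreal_ofReal)
    _ ≤ ∫⁻ Zm, ENNReal.ofReal (C ^ m) * gaussTupleWeight β Zm * G Zm := by
        refine lintegral_mono_ae ?_
        filter_upwards [hEnv, hsec] with Zm hZ hint
        gcongr
        calc ∫⁻ Zr, ENNReal.ofReal (ρ' (Fin.append Zm Zr))
            = ENNReal.ofReal (∫ Zr, ρ' (Fin.append Zm Zr)) :=
              (ofReal_integral_eq_lintegral_ofReal hint (ae_of_all _ fun _ => hρ0 _)).symm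
          _ = ENNReal.ofReal (nthMarginal (N + 1) m ρ Zm) := by
              rw [nthMarginal_of_le hm]
              rfl
          _ ≤ ENNReal.ofReal (C ^ m * Real.exp (-(β * configEnergy Zm))) :=
              ENNReal.ofReal_le_ofReal ((le_abs_self _).trans hZ)
          _ = ENNReal.ofReal (C ^ m) * gaussTupleWeight β Zm := by
              rw [ENNReal.ofReal_mul (pow_nonneg hC m)]
              rfl
    _ = ENNReal.ofReal (C ^ m) * ∫⁻ q, G q * gaussTupleWeight β q := by
        rw [← lintegral_const_mul (ENNReal.ofReal (C ^ m))
          (show Measurable (fun q : Fin m → T3 × V3 => G q * gaussTupleWeight β q) from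
            hG.mul (measurable_gaussTupleWeight β m))]
        refine lintegral_congr fun Zm => ?_
        ring

/-! ## §5 From the label-set form to the pair form (translation invariance of `𝕋³`) -/

/-- The pair coordinates `(x₀ - x₁, v₀, v₁)` push the Lebesgue measure of `(𝕋³ × ℝ³)²` forward to
the Lebesgue measure of `𝕋³ × ℝ³ × ℝ³`: the shear `(x₀, x₁) ↦ (x₀ - x₁, x₁)` preserves Haar ⊗ Haar
and the Haar measure of `𝕋³` has total mass one. -/
theorem measurePreserving_pairCoords :
    MeasurePreserving (fun q : Fin 2 → T3 × V3 => ((q 0).1 - (q 1).1, ((q 0).2, (q 1).2))) volume volume := by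
  haveI : IsProbabilityMeasure (volume : Measure T3) := ⟨by rw [volume_pi, Measure.pi_univ]; simp⟩
  have h1 : MeasurePreserving (MeasurableEquiv.arrowProdEquivProdArrow T3 V3 (Fin 2)) volume volume :=
    volume_measurePreserving_arrowProdEquivProdArrow T3 V3 (Fin 2)
  have h2 : MeasurePreserving (Prod.map (MeasurableEquiv.finTwoArrow (α := T3)) (MeasurableEquiv.finTwoArrow (α := V3)))
      (volume : Measure ((Fin 2 → T3) × (Fin 2 → V3))) (volume : Measure ((T3 × T3) × (V3 × V3))) :=
    (volume_preserving_finTwoArrow T3).prod (volume_preserving_finTwoArrow V3)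
  have h3 : MeasurePreserving (Prod.map (fun z : T3 × T3 => (z.1 - z.2, z.2)) id)
      (volume : Measure ((T3 × T3) × (V3 × V3))) (volume : Measure ((T3 × T3) × (V3 × V3))) :=
    (measurePreserving_sub_prod (volume : Measure T3) volume).prod (MeasurePreserving.id volume)
  have h4 : MeasurePreserving (Prod.map Prod.fst id)
      (volume : Measure ((T3 × T3) × (V3 × V3))) (volume : Measure (T3 × (V3 × V3))) :=
    measurePreserving_fst.prod (MeasurePreserving.id volume)
  convert ((h4.comp h3).comp h2).comp h1 using 1
  funext q
  rfl

/-- **Pair reduction**: integrating a function of `(x₀ - x₁, v₀, v₁)` against the pair Gaussian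
weight over `(𝕋³ × ℝ³)²` is integrating it over `𝕋³ × ℝ³ × ℝ³`. -/
theorem lintegral_pairCoords (β : ℝ) {G : T3 × V3 × V3 → ℝ≥0∞} (hG : Measurable G) :
    ∫⁻ q : Fin 2 → T3 × V3, G ((q 0).1 - (q 1).1, (q 0).2, (q 1).2) * gaussTupleWeight β q =
      ∫⁻ p : T3 × V3 × V3, G p * gaussPairWeight β p.2 := by
  have hF : Measurable fun p : T3 × V3 × V3 => G p * gaussPairWeight β p.2 :=
    hG.mul ((measurable_gaussPairWeight β).comp measurable_snd)
  rw [← measurePreserving_pairCoords.lintegral_comp hF]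
  refine lintegral_congr fun q => ?_
  simp only [gaussTupleWeight, gaussPairWeight, Fin.sum_univ_two]

/-- **Label-set envelope ⇒ pair-law envelope** (the `m = 2` case read in the pair coordinates). -/
theorem pairLawEnvelope_of_labelLawEnvelope {μ : Measure (Cfg N)} {C β : ℝ}
    (h : LabelLawEnvelope μ C β) : PairLawEnvelope μ C β := by
  intro k l hkl G hG
  have hf : Function.Injective ![k, l] := by
    intro i j hij
    fin_cases i <;> fin_cases j
    · rfl
    · exact absurd hij (by simpa using hkl)
    · exact absurd hij (by simpa using hkl.symm)
    · rfl
  have hG' : Measurable fun q : Fin 2 → T3 × V3 => G ((q 0).1 - (q 1).1, (q 0).2, (q 1).2) :=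
    hG.comp measurePreserving_pairCoords.measurable
  have h2 := h 2 ⟨![k, l], hf⟩ _ hG'
  rw [lintegral_pairCoords β hG] at h2
  simpa using h2

/-! ## §6 Assembly -/

/-- **Relabelling + first labels ⇒ label-set envelope**: a relabelling-invariant law whose
first-`m`-labels integrals obey the envelope for every `m ≤ N + 1` has the label-set envelope
(every injection `Fin m ↪ Fin (N+1)` extends to a permutation, `Equiv.Perm.exists_extending_pair`). -/
theorem labelLawEnvelope_of_castLE {μ : Measure (Cfg N)} {C β : ℝ}
    (hperm : ∀ π : Equiv.Perm (Fin (N + 1)), MeasurePreserving (fun w : Cfg N => (w ∘ π : Cfg N)) μ μ)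
    (hfirst : ∀ (m : ℕ) (hm : m ≤ N + 1) (G : (Fin m → T3 × V3) → ℝ≥0∞), Measurable G →
      ∫⁻ w, G (fun a => w (Fin.castLE hm a)) ∂μ ≤
        ENNReal.ofReal (C ^ m) * ∫⁻ q, G q * gaussTupleWeight β q) :
    LabelLawEnvelope μ C β := by
  intro m ι G hG
  have hm : m ≤ N + 1 := by simpa using Fintype.card_le_of_embedding ι
  obtain ⟨π, hπ⟩ := Equiv.Perm.exists_extending_pair (Fin.castLE hm) ι (Fin.castLE_injective hm) ι.injective
  have hGm : Measurable fun w : Cfg N => G fun a => w (Fin.castLE hm a) :=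
    hG.comp (measurable_pi_lambda _ fun _ => measurable_pi_apply _)
  calc ∫⁻ w, G (fun a => w (ι a)) ∂μ
      = ∫⁻ w, (fun w' : Cfg N => G fun a => w' (Fin.castLE hm a)) ((w ∘ π : Cfg N)) ∂μ := by
        simp only [Function.comp_apply, hπ]
    _ = ∫⁻ w, G (fun a => w (Fin.castLE hm a)) ∂μ := (hperm π).lintegral_comp hGm
    _ ≤ _ := hfirst m hm G hG

/-- **Registered stub `stub_labelEnvelopeOn`** (line `plaque-thinning-count-ld`, stub-5 plumbing
"(S)"): the marginal envelope of the transported local Gibbs density implies the label-set envelope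
of the laws at all times `r ∈ [0, t₁]`, and hence their pair envelope. -/
theorem stub_labelEnvelopeOn : LabelEnvelopeFromEnvelope := by
  intro a₀ θ₀ u₀ ha hθ hu ha0 hθ0 σ _hσ hσ2 Φ t₁ β C hC hE
  have hLab : LabelEnvelopeOn σ a₀ θ₀ u₀ Φ t₁ β C := by
    intro N r hr
    refine labelLawEnvelope_of_castLE
      (fun π => measurePreserving_comp_perm_map_flow ha hθ hu σ N (Φ N) π r) ?_
    intro m hm G hG
    exact lintegral_castLE_le ha hθ hu ha0 hθ0 hσ2 (Φ N) hm r β hC (hE N m r hr) hG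
  exact ⟨hLab, fun N r hr => pairLawEnvelope_of_labelLawEnvelope (hLab N r hr)⟩

end Summit.AtomisticToContinuum.HydrodynamicLimit.Theorems.CollisionActivityTailsEnvelopePlumbing

end
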